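import Summits.MatrixMultiplication.MatrixMultiplication.Theorems.SoloInformedCatalystAbundance
import HarnessLib

/-!
# The 111-algebra of every Kronecker power of `T_cw,2` is trivial: `dim 𝔞(T_cw,2^{⊠N}) ≤ 1`

Sub-problem `MatrixMultiplication` (solo line `solo-MatrixMultiplication-informed`, gen 17).
`SoloInformedCatalystAbundance.lean` showed `dim 𝔞(T_cw,2^{⊠N}) < 3^N` and hence that a finite
catalyst certificate `bR(T_cw,2^{⊠N} ⊕ s) ≤ 3^N + d` (the one identity that would give `ω = 2`
through `SoloInformedCatalystDoor.lean`) forces `dim 𝔞(s) > d`.  Here the exact value: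

* `finrank_ker_lin111_kroneckerPow_cwTensor_two_le_one` — `dim 𝔞(T_cw,2^{⊠N}) ≤ 1` for every `N`,
  over any field (so `𝔞 = K·(1,1,1)`);
* `le_finrank_ker_lin111_of_cwTensor_two_catalyst` — a certificate `bR(T_cw,2^{⊠N} ⊕ s) ≤ 3^N + d`
  with a concise `d × d × d` catalyst forces `dim 𝔞(s) ≥ 3^N + d - 1`: the catalyst is
  111-abundant with DEFECT at least `3^N - 1` (no concise 111-abundant non-sharp tensor is known,
  Jelisiejew–Landsberg–Pal 2023 §1.4.1; since `𝔞(s)` is a commutative subalgebra of `End(K^d)`,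
  JLP Thm. 1.10, Schur's bound `dim ≤ ⌊d²/4⌋ + 1` then forces `d ≥ 2 + 2√(3^N - 1)` informally).

Proof.  By `CatalystAbundance.finrank_ker_lin111_le_one` it suffices that the commutant of the
normalised slice space `S⁻¹T(A*)`, `T = T_cw,2^{⊠N}`, `S = T((a₀^*+a₁^*)^{⊗N})`, is scalar.  That
space contains the ONE-SITE operators `1 ⊗ ⋯ ⊗ X ⊗ ⋯ ⊗ 1`, `1 ⊗ ⋯ ⊗ Y ⊗ ⋯ ⊗ 1` with
`X = S₁⁻¹T_cw,2(a₀^*) = E₀₁ + E₂₂`, `Y = S₁⁻¹T_cw,2(a₂^*) = -E₀₂ + E₁₂ + E₂₀` (`normSlice_update`),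
and every matrix unit of `M₃(K)` is a product of `X`, `Y`, `Y + XY`:
`E₂₂ = X², E₀₂ = XY·E₂₂, E₂₀ = E₂₂Y, E₂₁ = E₂₀X, E₁₂ = (Y + XY)E₂₂`, the rest products of these.
Hence a matrix commuting with the one-site operators commutes with every one-site matrix unit
(`commute_oneSite_single`), with their products over all sites, which are exactly the matrix
units of `M_{3^N}(K)` (`piMatrix_single`), and is therefore scalar
(`Matrix.mem_range_scalar_of_commute_single`).

HONEST FRAMING: a theorem about explicit tensors that sharpens what a finite-level catalyst for
the `ω = 2` door must look like; it is not progress on `ω`.  0 sorries.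

References: J. Jelisiejew, J. M. Landsberg, A. Pal, *Concise tensors of minimal border rank*,
Math. Ann. 388 (2023), arXiv:2205.05713, Thm. 1.10, §1.4.1, Prop. 3.2 [JelisiejewLandsbergPal2023];
W. Buczyńska, J. Buczyński, *Apolarity, border rank, and multigraded Hilbert scheme*, Duke
Math. J. 170 (2021), Thm. 1.2 [BuczynskaBuczynski2021].
-/

noncomputable section

open scoped BigOperators Matrix
open Matrix

namespace Summit.MatrixMultiplication.MatrixMultiplication.Theorems

open Literature.Computability.AlgebraicComplexity OneOneOneSplit CatalystNoGo CatalystAbundance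

universe u

namespace CatalystScalar

section OneSite

variable {K : Type u} [CommRing K] {κ : Type*} [Fintype κ] [DecidableEq κ] {n : ℕ}

/-- The one-site operator `1 ⊗ ⋯ ⊗ M ⊗ ⋯ ⊗ 1` (`M` at site `l`). [folklore] -/
def oneSite (l : Fin n) (M : Matrix κ κ K) : Matrix (Fin n → κ) (Fin n → κ) K :=
  piMatrix (Function.update (fun _ => (1 : Matrix κ κ K)) l M)

omit [Fintype κ] [DecidableEq κ] in
/-- Entries of a Kronecker product with one factor replaced. [folklore] -/
theorem piMatrix_update_apply (F : Fin n → Matrix κ κ K) (l : Fin n) (M : Matrix κ κ K)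
    (b c : Fin n → κ) :
    piMatrix (Function.update F l M) b c =
      M (b l) (c l) * ∏ x ∈ Finset.univ \ {l}, F x (b x) (c x) := by
  rw [piMatrix_apply]
  have h : (fun x => Function.update F l M x (b x) (c x)) =
      Function.update (fun x => F x (b x) (c x)) l (M (b l) (c l)) := by
    funext x
    by_cases hx : x = l
    · subst hx; simp
    · simp [hx]
  rw [h, Finset.prod_update_of_mem (Finset.mem_univ l)]

omit [Fintype κ] in
/-- `M ↦ 1 ⊗ ⋯ ⊗ M ⊗ ⋯ ⊗ 1` is additive. [folklore] -/
theorem oneSite_add (l : Fin n) (M M' : Matrix κ κ K) :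
    oneSite l (M + M') = oneSite l M + oneSite l M' := by
  ext b c
  simp only [oneSite, Matrix.add_apply, piMatrix_update_apply, add_mul]

/-- `M ↦ 1 ⊗ ⋯ ⊗ M ⊗ ⋯ ⊗ 1` is multiplicative. [folklore] -/
theorem oneSite_mul (l : Fin n) (M M' : Matrix κ κ K) :
    oneSite l M * oneSite l M' = oneSite l (M * M') := by
  unfold oneSite
  rw [piMatrix_mul]
  congr 1
  funext x
  by_cases hx : x = l
  · subst hx; simp
  · simp [hx]

/-- The partial Kronecker product over the sites in `s` (identity elsewhere). [folklore] -/
def sitesProd (s : Finset (Fin n)) (G : Fin n → Matrix κ κ K) : Matrix (Fin n → κ) (Fin n → κ) K :=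
  piMatrix fun x => if x ∈ s then G x else 1

/-- Adding a site multiplies by its one-site operator. [folklore] -/
theorem sitesProd_insert {s : Finset (Fin n)} {l : Fin n} (hl : l ∉ s)
    (G : Fin n → Matrix κ κ K) : sitesProd (insert l s) G = sitesProd s G * oneSite l (G l) := by
  unfold sitesProd oneSite
  rw [piMatrix_mul]
  congr 1
  funext x
  by_cases hx : x = l
  · subst hx; simp [hl]
  · simp [hx, Finset.mem_insert]

/-- A matrix commuting with all one-site operators `1 ⊗ ⋯ ⊗ G_l ⊗ ⋯ ⊗ 1` commutes with
`G_1 ⊗ ⋯ ⊗ G_n`. [folklore] -/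
theorem commute_piMatrix_of_oneSite (W : Matrix (Fin n → κ) (Fin n → κ) K)
    (G : Fin n → Matrix κ κ K) (h : ∀ l, Commute (oneSite l (G l)) W) :
    Commute (piMatrix G) W := by
  have key : ∀ s : Finset (Fin n), Commute (sitesProd s G) W := by
    intro s
    induction s using Finset.induction_on with
    | empty =>
      have h1 : sitesProd ∅ G = 1 := by unfold sitesProd; simp [piMatrix_one]
      rw [h1]
      exact Commute.one_left W
    | insert l s hl ih =>
      rw [sitesProd_insert hl]
      exact ih.mul_left (h l)
  have hu : sitesProd Finset.univ G = piMatrix G := by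
    unfold sitesProd; simp only [Finset.mem_univ, if_true]
  rw [← hu]
  exact key _

omit [Fintype κ] in
/-- The Kronecker product of matrix units is a matrix unit. [folklore] -/
theorem piMatrix_single (b c : Fin n → κ) :
    piMatrix (fun l => Matrix.single (b l) (c l) (1 : K)) = Matrix.single b c 1 := by
  ext b' c'
  rw [piMatrix_apply, Matrix.single_apply]
  by_cases h : b = b' ∧ c = c'
  · obtain ⟨rfl, rfl⟩ := h
    simp
  · rw [if_neg h]
    obtain ⟨l, hl⟩ : ∃ l, ¬(b l = b' l ∧ c l = c' l) := by
      by_contra hcon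
      exact h ⟨funext fun l => (not_not.1 (not_exists.1 hcon l)).1,
        funext fun l => (not_not.1 (not_exists.1 hcon l)).2⟩
    exact Finset.prod_eq_zero (Finset.mem_univ l) (by rw [Matrix.single_apply, if_neg hl])

end OneSite

/-! ## The one-site normalised slices of `T_cw,2^{⊠N}` and the matrix units they generate -/

section CwTwo

variable (K : Type u) [Field K]

/-- `X = S⁻¹ T_cw,2(a₀^*) = E₀₁ + E₂₂`. [folklore] -/
def xMat : Matrix (Fin 3) (Fin 3) K := !![0, 1, 0; 0, 0, 0; 0, 0, 1]

/-- `Y = S⁻¹ T_cw,2(a₂^*) = -E₀₂ + E₁₂ + E₂₀`. [folklore] -/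
def yMat : Matrix (Fin 3) (Fin 3) K := !![0, 0, -1; 0, 0, 1; 1, 0, 0]

/-- `S⁻¹ T_cw,2(a₀^*) = X`. [folklore] -/
theorem cwSinv_mul_contractFirst_cwβ :
    cwSinv K * contractFirst (cwβ K) (cwTensor K 2) = xMat K := by
  rw [contractFirst_cwβ]
  ext i j
  fin_cases i <;> fin_cases j <;> simp [cwSinv, xMat, Matrix.mul_apply, Fin.sum_univ_three]

/-- `S⁻¹ T_cw,2(a₂^*) = Y`. [folklore] -/
theorem cwSinv_mul_contractFirst_cwγ :
    cwSinv K * contractFirst (cwγ K) (cwTensor K 2) = yMat K := by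
  rw [contractFirst_cwγ]
  ext i j
  fin_cases i <;> fin_cases j <;> simp [cwSinv, yMat, Matrix.mul_apply, Fin.sum_univ_three]

/-- `X² = E₂₂`. [folklore] -/
theorem xMat_mul_xMat : xMat K * xMat K = Matrix.single 2 2 1 := by
  ext i j
  fin_cases i <;> fin_cases j <;> simp [xMat, Matrix.mul_apply, Fin.sum_univ_three]

/-- `X Y E₂₂ = E₀₂`. [folklore] -/
theorem xMat_mul_yMat_mul_single :
    xMat K * yMat K * Matrix.single 2 2 1 = Matrix.single 0 2 1 := by
  ext i j
  fin_cases i <;> fin_cases j <;> simp [xMat, yMat, Matrix.mul_apply, Matrix.single_apply]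

/-- `E₂₂ Y = E₂₀`. [folklore] -/
theorem single_mul_yMat : Matrix.single 2 2 (1 : K) * yMat K = Matrix.single 2 0 1 := by
  ext i j
  fin_cases i <;> fin_cases j <;> simp [yMat, Matrix.mul_apply, Matrix.single_apply]

/-- `E₂₀ X = E₂₁`. [folklore] -/
theorem single_mul_xMat : Matrix.single 2 0 (1 : K) * xMat K = Matrix.single 2 1 1 := by
  ext i j
  fin_cases i <;> fin_cases j <;> simp [xMat, Matrix.mul_apply, Matrix.single_apply]

/-- `(Y + XY) E₂₂ = E₁₂`. [folklore] -/
theorem yMat_add_mul_single :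
    (yMat K + xMat K * yMat K) * Matrix.single 2 2 1 = Matrix.single 1 2 1 := by
  ext i j
  fin_cases i <;> fin_cases j <;> simp [xMat, yMat, Matrix.mul_apply, Matrix.single_apply]

variable {K}

/-- **`{X, Y}` generates `M₃(K)`:** a matrix commuting with the one-site operators of `X` and
`Y` at site `l` commutes with every one-site matrix unit at `l`. [folklore] -/
theorem commute_oneSite_single {n : ℕ} {W : Matrix (Fin n → Fin 3) (Fin n → Fin 3) K} (l : Fin n)
    (hX : Commute (oneSite l (xMat K)) W) (hY : Commute (oneSite l (yMat K)) W) (j k : Fin 3) :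
    Commute (oneSite l (Matrix.single j k (1 : K))) W := by
  have h22 : Commute (oneSite l (Matrix.single 2 2 (1 : K))) W := by
    rw [← xMat_mul_xMat, ← oneSite_mul]
    exact hX.mul_left hX
  have h02 : Commute (oneSite l (Matrix.single 0 2 (1 : K))) W := by
    rw [← xMat_mul_yMat_mul_single, ← oneSite_mul, ← oneSite_mul]
    exact (hX.mul_left hY).mul_left h22
  have h20 : Commute (oneSite l (Matrix.single 2 0 (1 : K))) W := by
    rw [← single_mul_yMat, ← oneSite_mul]
    exact h22.mul_left hY
  have h21 : Commute (oneSite l (Matrix.single 2 1 (1 : K))) W := by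
    rw [← single_mul_xMat, ← oneSite_mul]
    exact h20.mul_left hX
  have h12 : Commute (oneSite l (Matrix.single 1 2 (1 : K))) W := by
    rw [← yMat_add_mul_single, ← oneSite_mul, oneSite_add, ← oneSite_mul]
    exact (hY.add_left (hX.mul_left hY)).mul_left h22
  have hprod : ∀ i m : Fin 3, Commute (oneSite l (Matrix.single i 2 (1 : K))) W →
      Commute (oneSite l (Matrix.single 2 m (1 : K))) W →
      Commute (oneSite l (Matrix.single i m (1 : K))) W := fun i m hi hm => by
    rw [show Matrix.single i m (1 : K) = Matrix.single i 2 1 * Matrix.single 2 m 1 by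
      rw [Matrix.single_mul_single_same, mul_one], ← oneSite_mul]
    exact hi.mul_left hm
  have h00 := hprod 0 0 h02 h20
  have h01 := hprod 0 1 h02 h21
  have h10 := hprod 1 0 h12 h20
  have h11 := hprod 1 1 h12 h21
  fin_cases j <;> fin_cases k
  all_goals first
    | exact h00 | exact h01 | exact h02 | exact h10 | exact h11 | exact h12 | exact h20
    | exact h21 | exact h22

variable (K)

/-- `S^{⊗N}` has inverse `(S⁻¹)^{⊗N}`. [folklore] -/
theorem inv_contractFirst_prodCovector_cwα (n : ℕ) :
    (contractFirst (prodCovector fun _ : Fin n => cwα K) (kroneckerPow (cwTensor K 2) n))⁻¹ =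
      piMatrix fun _ : Fin n => cwSinv K := by
  apply Matrix.inv_eq_left_inv
  rw [contractFirst_prodCovector_kroneckerPow, piMatrix_mul]
  simp only [cwSinv_mul_S]
  exact piMatrix_one n

/-- **One-site normalised slices.**  Contracting `T_cw,2^{⊠N}` with the covector
`(a₀^*+a₁^*) ⊗ ⋯ ⊗ δ ⊗ ⋯ ⊗ (a₀^*+a₁^*)` (`δ` at site `l`) and normalising by `S^{⊗N}` gives the
one-site operator of `S⁻¹T_cw,2(δ)`. [folklore] -/
theorem normSlice_update (n : ℕ) (l : Fin n) (δ : Fin 3 → K) :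
    (contractFirst (prodCovector fun _ : Fin n => cwα K) (kroneckerPow (cwTensor K 2) n))⁻¹ *
      contractFirst (prodCovector (Function.update (fun _ : Fin n => cwα K) l δ))
        (kroneckerPow (cwTensor K 2) n) =
      oneSite l (cwSinv K * contractFirst δ (cwTensor K 2)) := by
  rw [inv_contractFirst_prodCovector_cwα, contractFirst_prodCovector_kroneckerPow, piMatrix_mul]
  unfold oneSite
  congr 1
  funext x
  by_cases hx : x = l
  · subst hx; simp
  · simp [hx, cwSinv_mul_S]

/-- **`dim 𝔞(T_cw,2^{⊠N}) ≤ 1` for every `N`, over any field**: the 111-algebra of every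
Kronecker power of the small Coppersmith–Winograd tensor `T_cw,2` is `K·(1,1,1)`.
[cite: JelisiejewLandsbergPal2023, Prop. 3.2] -/
theorem finrank_ker_lin111_kroneckerPow_cwTensor_two_le_one (n : ℕ) :
    Module.finrank K (LinearMap.ker (lin111 (kroneckerPow (cwTensor K 2) n))) ≤ 1 := by
  refine finrank_ker_lin111_le_one _ (isConcise3_kroneckerPow_cwTensor_two K n).1
    (prodCovector fun _ : Fin n => cwα K) (isUnit_contractFirst_prodCovector_cwα K n) ?_
  intro W hW
  apply Matrix.mem_range_scalar_of_commute_single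
  intro b c _
  have hl : ∀ l : Fin n,
      Commute (oneSite l (xMat K)) W ∧ Commute (oneSite l (yMat K)) W := fun l => by
    constructor
    · have h := hW (prodCovector (Function.update (fun _ : Fin n => cwα K) l (cwβ K)))
      rwa [normSlice_update, cwSinv_mul_contractFirst_cwβ] at h
    · have h := hW (prodCovector (Function.update (fun _ : Fin n => cwα K) l (cwγ K)))
      rwa [normSlice_update, cwSinv_mul_contractFirst_cwγ] at h
  rw [← piMatrix_single]
  exact commute_piMatrix_of_oneSite W _ fun l =>
    commute_oneSite_single l (hl l).1 (hl l).2 (b l) (c l)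

end CwTwo

end CatalystScalar

/-! ## What a finite catalyst certificate forces: 111-abundance with defect `3^N - 1` -/

section Main

open CatalystScalar

variable (K : Type u) [Field K]
variable {ι' κ' μ' : Type*} [Fintype ι'] [Fintype κ'] [Fintype μ'] [DecidableEq ι']
  [DecidableEq κ'] [DecidableEq μ']

omit [DecidableEq ι'] [DecidableEq κ'] [DecidableEq μ'] in
/-- `dim 𝔞(T_cw,2^{⊠N} ⊕ s) ≤ 1 + dim 𝔞(s)` for concise `s`. [folklore] -/
theorem finrank_ker_lin111_kroneckerPow_cwTensor_two_directSum_le (s : ι' → κ' → μ' → K)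
    (hs : IsConcise3 s) (n : ℕ) :
    Module.finrank K (LinearMap.ker (lin111 (directSumTensor (kroneckerPow (cwTensor K 2) n) s)))
      ≤ 1 + Module.finrank K (LinearMap.ker (lin111 s)) :=
  (finrank_ker_lin111_directSum_le (isConcise3_kroneckerPow_cwTensor_two K n) hs).trans
    (Nat.add_le_add_right (finrank_ker_lin111_kroneckerPow_cwTensor_two_le_one K n) _)

/-- **A finite catalyst certificate forces a maximally non-sharp 111-abundant catalyst.**  If
`bR(T_cw,2^{⊠N} ⊕ s) ≤ 3^N + d` for a concise `s ∈ K^d ⊗ K^d ⊗ K^d` (the identity the catalyst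
door for `ω = 2` needs, with `Q̃(s) ≤ d`), then `dim 𝔞(s) ≥ 3^N + d - 1`, i.e. `s` is
111-abundant with defect `≥ 3^N - 1` (no concise 111-abundant non-111-sharp tensor is known,
JLP 2023 §1.4.1).  Over any field, every `N`.
[cite: BuczynskaBuczynski2021, Thm. 1.2] [cite: JelisiejewLandsbergPal2023, §1.4.1, Prop. 3.2] -/
theorem le_finrank_ker_lin111_of_cwTensor_two_catalyst (s : ι' → κ' → μ' → K)
    (hs : IsConcise3 s) {d : ℕ} (hι : Fintype.card ι' = d) (hκ : Fintype.card κ' = d)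
    (hμ : Fintype.card μ' = d) (n : ℕ)
    (hcert : algBorderRank (directSumTensor (kroneckerPow (cwTensor K 2) n) s) ≤ 3 ^ n + d) :
    3 ^ n + d ≤ 1 + Module.finrank K (LinearMap.ker (lin111 s)) := by
  by_contra hlt
  have hDc := isConcise3_directSumTensor (isConcise3_kroneckerPow_cwTensor_two K n) hs
  have h1 := finrank_ker_lin111_kroneckerPow_cwTensor_two_directSum_le K s hs n
  have hbr := lt_algBorderRank_of_finrank_ker_lin111_lt K _ hDc.1 hDc.2.1 hDc.2.2
    (by simp [Fintype.card_sum, hι]) (by simp [Fintype.card_sum, hκ])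
    (by simp [Fintype.card_sum, hμ]) (lt_of_le_of_lt h1 (not_le.1 hlt))
  exact absurd hcert (not_le.2 hbr)


omit [DecidableEq ι'] [DecidableEq κ'] [DecidableEq μ'] in
/-- **`dim 𝔞(s) ≤ d²` for concise `s`.**  The projection `(P,Q,R) ↦ Rᵀ` of the 111-space of a
concise tensor is injective: `R = 0 ⟹ Q ·₂ s = R ·₃ s = 0 ⟹ Q = 0 ⟹ P ·₁ s = 0 ⟹ P = 0`.
[cite: JelisiejewLandsbergPal2023, Thm. 1.10 (injectivity of the projections), Lemma 3.1] -/
theorem finrank_ker_lin111_le_card_mul_card (s : ι' → κ' → μ' → K) (hs : IsConcise3 s) :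
    Module.finrank K (LinearMap.ker (lin111 s)) ≤ Fintype.card μ' * Fintype.card μ' := by
  let θ := (rBlockTLin (ι := ι') (κ := κ') (μ := μ') (K := K)).comp
    (LinearMap.ker (lin111 s)).subtype
  have hθinj : Function.Injective θ := (injective_iff_map_eq_zero θ).2 fun c hc => by
    obtain ⟨hPQ, hQR⟩ := (lin111_eq_zero_iff s c.1).1 c.2
    have h0 : rBlockT c.1 = 0 := hc
    have hR : ∀ k k', c.1 (Sum.inr (Sum.inr (k, k'))) = 0 := fun k k' => by
      have := congr_fun (congr_fun h0 k') k
      simpa [rBlockT] using this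
    have hc3 : contract₃ (fun y y' => c.1 (Sum.inr (Sum.inr (y, y')))) s = 0 := by
      funext i j k
      simp [contract₃_apply, hR]
    have hc2 : contract₂ (fun x x' => c.1 (Sum.inr (Sum.inl (x, x')))) s = 0 := hQR.trans hc3
    have hQ : ∀ j j', c.1 (Sum.inr (Sum.inl (j, j'))) = 0 := by
      intro j
      refine Fintype.linearIndependent_iff.1 hs.2.1
        (fun j' => c.1 (Sum.inr (Sum.inl (j, j')))) ?_
      funext k i
      have := congr_fun (congr_fun (congr_fun hc2 i) j) k
      simpa [contract₂_apply, Finset.sum_apply, rotate] using this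
    have hc1 : contract₁ (fun z z' => c.1 (Sum.inl (z, z'))) s = 0 := hPQ.trans hc2
    have hP : ∀ i i', c.1 (Sum.inl (i, i')) = 0 := by
      intro i
      refine Fintype.linearIndependent_iff.1 hs.1 (fun i' => c.1 (Sum.inl (i, i'))) ?_
      funext j k
      have := congr_fun (congr_fun (congr_fun hc1 i) j) k
      simpa [contract₁_apply, Finset.sum_apply] using this
    refine Subtype.ext (funext fun t => ?_)
    rcases t with ⟨i, i'⟩ | ⟨j, j'⟩ | ⟨k, k'⟩
    exacts [hP i i', hQ j j', hR k k']
  calc Module.finrank K (LinearMap.ker (lin111 s))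
      ≤ Module.finrank K (Matrix μ' μ' K) := LinearMap.finrank_le_finrank_of_injective hθinj
    _ = Fintype.card μ' * Fintype.card μ' := by simp [Module.finrank_matrix]

/-- **Size of a finite-level catalyst.**  A certificate `bR(T_cw,2^{⊠N} ⊕ s) ≤ 3^N + d` with a
concise `d × d × d` catalyst `s` forces `3^N + d ≤ 1 + d²`: the catalyst format grows at least
like `3^{N/2}` (with the commutativity of `𝔞(s)`, JLP23 Thm. 1.10, and Schur's bound on
commutative matrix algebras one gets `d ≥ 2 + 2√(3^N - 1)`; not formalised here).
[cite: JelisiejewLandsbergPal2023, Thm. 1.10, §1.4.1] [cite: BuczynskaBuczynski2021, Thm. 1.2] -/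
theorem pow_add_le_of_cwTensor_two_catalyst (s : ι' → κ' → μ' → K) (hs : IsConcise3 s) {d : ℕ}
    (hι : Fintype.card ι' = d) (hκ : Fintype.card κ' = d) (hμ : Fintype.card μ' = d) (n : ℕ)
    (hcert : algBorderRank (directSumTensor (kroneckerPow (cwTensor K 2) n) s) ≤ 3 ^ n + d) :
    3 ^ n + d ≤ 1 + d * d := by
  have h := le_finrank_ker_lin111_of_cwTensor_two_catalyst K s hs hι hκ hμ n hcert
  have h' := finrank_ker_lin111_le_card_mul_card K s hs
  rw [hμ] at h'
  omega

end Main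

end Summit.MatrixMultiplication.MatrixMultiplication.Theorems

end
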